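import Mathlib
import Summits.ValiantsHypothesis.ValiantsHypothesis.Theorems.FifoMatchingNNLinearDegreeCofactorHardShedWordBand
import Summits.ValiantsHypothesis.ValiantsHypothesis.Theorems.FifoMatchingNNLinearDegreeCofactorHardQueueDichotomy
import HarnessLib

/-!
# Crux `NNLinearDegreeCofactorHard` (stmt-ValiantsHypothesis-23918), line `internal_cofactor`, stub S2b (ii):
# μ* = shedWord as an instance of the (D*) abstract units — preliminaries (unit U5a)

The abstract units U1–U4 (`…QueueGenerations/Transfer/TransferS/Dichotomy/FreeMass`, ns `QueueHistory`) are stated for an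
abstract history `W rO rC o c σ isS`.  Here the μ* word `shedWord R H E y` (`…ShedWordDefs/Queue/History/Content/Band`) is
plugged in: `W := shedLetter`, `rO/rC := pushes/pops ∘ shedPrefix`, `o := openTime`, `c := closeTime hbal`,
`isS k := !isRItem k`, `σ t := decide (t ∈ S.map valEmbedding)` for a set of positions `S`.  This file proves the hypotheses
of `QueueHistory.dichotomy` that are facts about μ* alone:

* `ns_shedWord` — **NS**: before the tail, an S-push (a push at a non-defect position) with a non-empty queue has an S-front
  (`isDefect_frontPos_eq_false_of_push`);
* `sAlive_eq_sContent`, `sContent_add_sPush` — the abstract alive-S count is `sContent`, and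
  `sContent u + sPush[u,v) = sContent v + sPop[u,v)`; hence **the S-band gives the window hypothesis**
  `sPush ≤ sPop + 2m` (`sPush_le_sPop_add`) when `|fairWalk| < m` on `[H, E]` (`sContent_mem_band`);
* `card_rItems_le` — the R-items number at most `#R`;  `sPop_le_sAlive` — S-pops inside one generation pop distinct alive
  S-items.

Nothing here proves S2b, the crux or VP ≠ VNP (not proved). [folklore]
-/

noncomputable section

-- Sub = Summit single-conjunct layout: the duplicated namespace component is mandated by the tree.
set_option linter.dupNamespace false

namespace Summit.ValiantsHypothesis.ValiantsHypothesis.Theorems.FifoMatching.NNLinearDegreeCofactorHard.ShedWord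

open Finset Literature.Computability.AlgebraicComplexity
open Summit.ValiantsHypothesis.ValiantsHypothesis.Theorems.FifoMatching.NNMonotoneHard
open Summit.ValiantsHypothesis.ValiantsHypothesis.Theorems.FifoMatching.NNLinearDegreeCofactorHard.QueueHistory

variable {N : ℕ} (R : Finset (Fin N)) (H E : ℕ) (y : Fin N → Bool)

/-! ### NS: S-pushes have S-fronts -/

/-- `isS := fun k => !isRItem k` unfolds: `(!isRItem k) = true ↔ isRItem k = false`. [folklore] -/
theorem not_isRItem_eq_true_iff (k : ℕ) : (!isRItem R H E y k) = true ↔ isRItem R H E y k = false := by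
  cases isRItem R H E y k <;> simp

/-- **NS for μ***: on `[H, E)` with a non-empty queue, a push creating an S-item happens on an S-front. [folklore] -/
theorem ns_shedWord (hEN : E ≤ N) {t : ℕ} (hHt : H ≤ t) (htE : t < E)
    (hne : pops (shedPrefix R H E y t) < pushes (shedPrefix R H E y t)) (hpush : shedLetter R H E y t = true)
    (hS : (!isRItem R H E y (pushes (shedPrefix R H E y t))) = true) :
    (!isRItem R H E y (pops (shedPrefix R H E y t))) = true := by
  have htN : t < N := lt_of_lt_of_le htE hEN
  rw [not_isRItem_eq_true_iff, isRItem_pushes R H E y htN hpush] at hS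
  rw [not_isRItem_eq_true_iff, isRItem_pops R H E y (le_of_lt htN) hne]
  exact isDefect_frontPos_eq_false_of_push R H E y hS hHt htE hne hpush

/-! ### The abstract alive-S count is the S-content; S-pushes and S-pops move it -/

/-- `sAlive` of the instantiated history is `sContent`. [folklore] -/
theorem sAlive_eq_sContent (t : ℕ) :
    sAlive (fun s => pushes (shedPrefix R H E y s)) (fun s => pops (shedPrefix R H E y s)) (fun k => !isRItem R H E y k) t =
      sContent R H E y t := by
  unfold sAlive sContent
  congr 1
  exact filter_congr fun k _ => not_isRItem_eq_true_iff R H E y k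

/-- The `isR` argument of the abstract counts, instantiated: `!!isRItem = isRItem`. [folklore] -/
theorem not_not_isRItem : (fun k => !(fun k => !isRItem R H E y k) k) = isRItem R H E y := by
  funext k; simp

/-- **`sContent u + sPush[u,v) = sContent v + sPop[u,v)`** for `u ≤ v ≤ N`. [folklore] -/
theorem sContent_add_sPush {u v : ℕ} (huv : u ≤ v) (hvN : v ≤ N) :
    sContent R H E y u + sPush (shedLetter R H E y) (fun s => pushes (shedPrefix R H E y s)) (isRItem R H E y) u v =
      sContent R H E y v + sPop (shedLetter R H E y) (fun s => pops (shedPrefix R H E y s)) (isRItem R H E y) u v := by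
  classical
  induction v, huv using Nat.le_induction with
  | base => simp [sPush, sPop]
  | succ v huv ih =>
    have ih := ih (Nat.le_of_succ_le hvN)
    have hvN' : v < N := hvN
    have hU : sPush (shedLetter R H E y) (fun s => pushes (shedPrefix R H E y s)) (isRItem R H E y) u (v + 1) =
        sPush (shedLetter R H E y) (fun s => pushes (shedPrefix R H E y s)) (isRItem R H E y) u v +
          (if shedLetter R H E y v = true ∧ isRItem R H E y (pushes (shedPrefix R H E y v)) = false then 1 else 0) := by
      unfold sPush
      rw [Nat.Ico_succ_right_eq_insert_Ico huv, filter_insert]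
      split_ifs with h
      · rw [card_insert_of_notMem (by simp)]
      · rfl
    have hD : sPop (shedLetter R H E y) (fun s => pops (shedPrefix R H E y s)) (isRItem R H E y) u (v + 1) =
        sPop (shedLetter R H E y) (fun s => pops (shedPrefix R H E y s)) (isRItem R H E y) u v +
          (if shedLetter R H E y v = false ∧ isRItem R H E y (pops (shedPrefix R H E y v)) = false then 1 else 0) := by
      unfold sPop
      rw [Nat.Ico_succ_right_eq_insert_Ico huv, filter_insert]
      split_ifs with h
      · rw [card_insert_of_notMem (by simp)]
      · rfl
    rw [hU, hD]
    cases hl : shedLetter R H E y v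
    · -- a pop
      have hstep := sContent_succ_of_pop R H E y hvN' hl
      have hne := (pops_lt_pushes_of_shedLetter_eq_false R H E y hl).2.2
      rw [← isRItem_pops R H E y (le_of_lt hvN') hne] at hstep
      simp only [Bool.false_eq_true, false_and, if_false, add_zero, true_and]
      by_cases hr : isRItem R H E y (pops (shedPrefix R H E y v)) = true
      · rw [hr] at hstep; simp only [if_true, add_zero] at hstep
        rw [hr]; simp; omega
      · rw [Bool.not_eq_true] at hr
        rw [hr] at hstep ⊢; simp only [Bool.false_eq_true, if_false] at hstep
        simp; omega
    · -- a push
      have hstep := sContent_succ_of_push R H E y hvN' hl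
      rw [← isRItem_pushes R H E y hvN' hl] at hstep
      simp only [true_and, Bool.true_eq_false, false_and, if_false, add_zero]
      by_cases hr : isRItem R H E y (pushes (shedPrefix R H E y v)) = true
      · rw [hr] at hstep ⊢; simp only [if_true, add_zero] at hstep; simp; omega
      · rw [Bool.not_eq_true] at hr
        rw [hr] at hstep ⊢; simp only [Bool.false_eq_true, if_false] at hstep; simp; omega

/-! ### The band -/

/-- **S-content in the band**: if `|fairWalk| < m` on `[H, t]` and `m ≤ freeCount R 0 H` then on `[H, t]` the queue is
non-empty and `freeCount R 0 H − m < sContent < freeCount R 0 H + m` (as integers). [folklore] -/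
theorem sContent_mem_band (hEN : E ≤ N) {m : ℕ} (hm : m ≤ freeCount R 0 H) {t : ℕ} (hHt : H ≤ t) (htE : t ≤ E)
    (hband : ∀ s, H ≤ s → s ≤ t → |fairWalk R H E y s| < m) :
    ((freeCount R 0 H : ℤ) - m < sContent R H E y t ∧ (sContent R H E y t : ℤ) < freeCount R 0 H + m) ∧
      pops (shedPrefix R H E y t) < pushes (shedPrefix R H E y t) := by
  have hwalk : ∀ s, H ≤ s → s ≤ t → -(freeCount R 0 H : ℤ) < fairWalk R H E y s := fun s h1 h2 => by
    have := hband s h1 h2; rw [abs_lt] at this; omega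
  obtain ⟨_, heq⟩ := sContent_eq_of_walk_gt R H E y hEN hHt htE hwalk
  have hb := hband t hHt le_rfl
  rw [abs_lt] at hb
  refine ⟨⟨by omega, by omega⟩, pops_lt_pushes_of_sContent_pos R H E y ?_⟩
  have : (0 : ℤ) < sContent R H E y t := by omega
  exact_mod_cast this

/-- **The S-band window hypothesis**: `sPush[u,v) ≤ sPop[u,v) + 2m` for `H ≤ u ≤ v ≤ E` in the band. [folklore] -/
theorem sPush_le_sPop_add (hEN : E ≤ N) {m : ℕ} (hm : m ≤ freeCount R 0 H) {u v : ℕ} (hHu : H ≤ u) (huv : u ≤ v)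
    (hvE : v ≤ E) (hband : ∀ s, H ≤ s → s ≤ E → |fairWalk R H E y s| < m) :
    sPush (shedLetter R H E y) (fun s => pushes (shedPrefix R H E y s)) (isRItem R H E y) u v ≤
      sPop (shedLetter R H E y) (fun s => pops (shedPrefix R H E y s)) (isRItem R H E y) u v + 2 * m := by
  have h := sContent_add_sPush R H E y huv (hvE.trans hEN)
  have hu := (sContent_mem_band R H E y hEN hm hHu (huv.trans hvE) fun s h1 h2 => hband s h1 (h2.trans (huv.trans hvE))).1
  have hv := (sContent_mem_band R H E y hEN hm (hHu.trans huv) hvE fun s h1 h2 => hband s h1 (h2.trans hvE)).1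
  omega

/-! ### R-items and S-pops -/

/-- **The R-items number at most `#R`** (an R-item is pushed at a defect, and items are pushed at distinct positions).
[folklore] -/
theorem card_rItems_le :
    ((range (openerSet (shedWord R H E y)).card).filter fun k => isRItem R H E y k = true).card ≤ R.card := by
  classical
  set A := (range (openerSet (shedWord R H E y)).card).filter fun k => isRItem R H E y k = true with hA
  have hinj : Set.InjOn (openTime R H E y) ↑A := by
    intro k₁ h₁ k₂ h₂ heq
    have h₁' := mem_range.1 (mem_filter.1 (mem_coe.1 h₁)).1
    have h₂' := mem_range.1 (mem_filter.1 (mem_coe.1 h₂)).1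
    unfold openTime at heq
    rw [dif_pos h₁', dif_pos h₂'] at heq
    have := ((openerSet (shedWord R H E y)).orderEmbOfFin rfl).injective (Fin.ext heq)
    simpa using this
  have hsub : A.image (openTime R H E y) ⊆ R.map Fin.valEmbedding := by
    intro t ht
    rw [mem_image] at ht
    obtain ⟨k, hk, rfl⟩ := ht
    rw [hA, mem_filter, mem_range] at hk
    have h := hk.2
    unfold isRItem at h
    rw [← openTime_eq_nthTrue R H E y hk.1] at h
    simpa [isDefect] using h
  have h1 : A.card = (A.image (openTime R H E y)).card := (card_image_of_injOn hinj).symm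
  have h2 : (A.image (openTime R H E y)).card ≤ (R.map Fin.valEmbedding).card := card_le_card hsub
  rw [card_map] at h2
  omega

/-- **S-pops inside one generation number at most the S-items alive at its start** (window `[T, v)`, `v ≤ gen T`). [folklore] -/
theorem sPop_le_sAlive (hbal : (closerSet (shedWord R H E y)).card = (openerSet (shedWord R H E y)).card)
    (S : Finset (Fin N)) {T v : ℕ} (hne : pops (shedPrefix R H E y T) < pushes (shedPrefix R H E y T)) (hTN : T ≤ N)
    (hv : v ≤ gen (closeTime R H E y hbal) (fun s => pushes (shedPrefix R H E y s)) T) :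
    sPop (shedLetter R H E y) (fun s => pops (shedPrefix R H E y s)) (isRItem R H E y) T v ≤ sContent R H E y T := by
  classical
  have hnT : pushes (shedPrefix R H E y T) ≤ (openerSet (shedWord R H E y)).card := by
    rw [← pushes_shedPrefix_N]; exact pushes_mono R H E y hTN
  set σ : ℕ → Bool := fun t => decide (t ∈ S.map Fin.valEmbedding)
  have hmono : sPop (shedLetter R H E y) (fun s => pops (shedPrefix R H E y s)) (isRItem R H E y) T v ≤
      sPop (shedLetter R H E y) (fun s => pops (shedPrefix R H E y s)) (isRItem R H E y) T
        (gen (closeTime R H E y hbal) (fun s => pushes (shedPrefix R H E y s)) T) := by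
    unfold sPop; exact card_le_card (filter_subset_filter _ (Ico_subset_Ico le_rfl hv))
  have hsplit : ∀ u w, sPop (shedLetter R H E y) (fun s => pops (shedPrefix R H E y s)) (isRItem R H E y) u w =
      bPop (shedLetter R H E y) σ (fun s => pops (shedPrefix R H E y s)) (openTime R H E y) (isRItem R H E y) true u w +
      bPop (shedLetter R H E y) σ (fun s => pops (shedPrefix R H E y s)) (openTime R H E y) (isRItem R H E y) false u w := by
    intro u w
    unfold sPop bPop
    rw [← card_union_of_disjoint]
    · congr 1; ext t; simp only [mem_union, mem_filter]
      constructor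
      · rintro ⟨h1, h2, h3⟩
        cases hσ : σ (openTime R H E y (pops (shedPrefix R H E y t)))
        · exact Or.inr ⟨h1, h2, h3, rfl⟩
        · exact Or.inl ⟨h1, h2, h3, rfl⟩
      · rintro (⟨h1, h2, h3, -⟩ | ⟨h1, h2, h3, -⟩) <;> exact ⟨h1, h2, h3⟩
    · exact disjoint_filter.2 fun t _ h1 h2 => by rw [h1.2.2] at h2; exact Bool.noConfusion h2.2.2
  have hCs : ∀ t, (fun s => pops (shedPrefix R H E y s)) (t + 1) =
      (fun s => pops (shedPrefix R H E y s)) t + (if shedLetter R H E y t = true then 0 else 1) := fun t => rankC_succ R H E y t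
  have hc : ∀ k t, k < (openerSet (shedWord R H E y)).card →
      (closeTime R H E y hbal k < t ↔ k < (fun s => pops (shedPrefix R H E y s)) t) :=
    fun k t hk => closeTime_lt_iff R H E y hbal hk t
  have h1 := card_bPop_le_aliveS (W := shedLetter R H E y) (σ := σ) (rO := fun s => pushes (shedPrefix R H E y s))
    (o := openTime R H E y) (isR := isRItem R H E y) hCs hc true hne hnT
  have h2 := card_bPop_le_aliveS (W := shedLetter R H E y) (σ := σ) (rO := fun s => pushes (shedPrefix R H E y s))
    (o := openTime R H E y) (isR := isRItem R H E y) hCs hc false hne hnT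
  have h3 : aliveS σ (fun s => pushes (shedPrefix R H E y s)) (fun s => pops (shedPrefix R H E y s)) (openTime R H E y)
        (isRItem R H E y) true T +
      aliveS σ (fun s => pushes (shedPrefix R H E y s)) (fun s => pops (shedPrefix R H E y s)) (openTime R H E y)
        (isRItem R H E y) false T = sContent R H E y T := by
    have h := aliveS_add_aliveS (σ := σ) (rO := fun s => pushes (shedPrefix R H E y s))
      (rC := fun s => pops (shedPrefix R H E y s)) (o := openTime R H E y) (isS := fun k => !isRItem R H E y k) true T
    rw [sAlive_eq_sContent] at h
    simpa using h
  rw [hsplit T v, hsplit T (gen (closeTime R H E y hbal) (fun s => pushes (shedPrefix R H E y s)) T)] at hmono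
  rw [hsplit T v]
  omega

end Summit.ValiantsHypothesis.ValiantsHypothesis.Theorems.FifoMatching.NNLinearDegreeCofactorHard.ShedWord
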